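import Summits.Ventures.PercRepro.SixThreeStep5B

/-!
# PercRepro — Step 5 of Lemma PL (`g ≥ 41`), continuation `SixThreeStep5C` (p3 gen 8; split of the gen-7 module
`SixThreeStep5.lean` into five parts per the 400-line lint, proofs byte-identical, preambles only)

Parts IV–V (first half) of the original module: one line of size `m` (`3 ≤ m ≤ g − 1`) — counts, signs, the lower
bound on `F_t(g, [m])`; `Δ_t(g, [m]) ≥ 2^m·c_t(j) − loss` with the coefficient `c_t(j)` (`cNum_ge`).  Continues in
`SixThreeStep5D.lean`.
-/

namespace PercRepro.SixThree.Table

/-! ## Part IV: one line of size `m` (`3 ≤ m ≤ g − 1`): counts, signs, and the lower bound on `F_t(g, [m])` -/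

/-- `T(g, [m]) = C(g,3) − C(m,3)`. -/
theorem Tcnt_single (g m : ℕ) : Tcnt g [m] = (g.choose 3 : ℕ) - (m.choose 3 : ℕ) := by
  simp [Tcnt, ch_eq_choose]
/-- `N₄^c(g, [m]) = C(m,3)·(g − m)`. -/
theorem N4c_single (g m : ℕ) : N4c g [m] = (m.choose 3 : ℕ) * ((g - m : ℕ) : ℚ) := by
  simp [N4c, ch_eq_choose]
/-- `lp_s(g, [m]) = (g − m)·C(m, s−1)`. -/
theorem lps_single (g m s : ℕ) : lps g [m] s = ((g - m : ℕ) : ℚ) * (m.choose (s - 1) : ℕ) := by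
  simp [lps, ch_eq_choose]
/-- `d_s(g, [m])`: `C(m, s−2)·C(g−m, 2)` for `s ≥ 6`, `N_s − lp_s` at `s = 5`. -/
theorem ds_single (g m s : ℕ) : ds g [m] s = if 6 ≤ s then ((m.choose (s - 2) : ℕ) : ℚ) * (((g - m).choose 2 : ℕ) : ℚ)
    else (((g.choose s : ℕ) : ℚ) - ((m.choose s : ℕ) : ℚ)) - ((g - m : ℕ) : ℚ) * ((m.choose (s - 1) : ℕ) : ℚ) := by
  simp only [ds, Ns, lps, ch_eq_choose, List.map_cons, List.map_nil, List.sum_cons, List.sum_nil, add_zero]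
/-- `rest_s(g, [m]) = N_s − lp_s − d_s`. -/
theorem rests_single (g m s : ℕ) : rests g [m] s =
    ((g.choose s : ℕ) - (m.choose s : ℕ)) - ((g - m : ℕ) : ℚ) * (m.choose (s - 1) : ℕ) - ds g [m] s := by
  simp only [rests, Ns, lps, ch_eq_choose, List.map_cons, List.map_nil, List.sum_cons, List.sum_nil, add_zero]

/-- `N₄^g(g, [m]) = C(g,4) − C(m,4) − (g − m)·C(m,3)` for `3 ≤ m ≤ g`. -/
theorem N4g_single {g m : ℕ} (hm3 : 3 ≤ m) (hmg : m ≤ g) :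
    N4g g [m] = (g.choose 4 : ℕ) - (m.choose 4 : ℕ) - ((g - m : ℕ) : ℚ) * (m.choose 3 : ℕ) := by
  have h1 : (g.choose 4 : ℚ) * 4 = (g.choose 3 : ℚ) * ((g - 3 : ℕ) : ℚ) := by
    exact_mod_cast Nat.choose_succ_right_eq g 3
  have h2 : (m.choose 4 : ℚ) * 4 = (m.choose 3 : ℚ) * ((m - 3 : ℕ) : ℚ) := by
    exact_mod_cast Nat.choose_succ_right_eq m 3
  have e1 : ((g - 3 : ℕ) : ℚ) = g - 3 := by rw [Nat.cast_sub (by omega)]; push_cast; ring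
  have e2 : ((m - 3 : ℕ) : ℚ) = m - 3 := by rw [Nat.cast_sub hm3]; push_cast; ring
  have e3 : ((g - m : ℕ) : ℚ) = g - m := by rw [Nat.cast_sub hmg]
  rw [e1] at h1; rw [e2] at h2
  simp only [N4g, Tcnt_single, N4c_single, e1, e3]
  linear_combination (-1 / 4 : ℚ) * h1 + (1 / 4 : ℚ) * h2

/-- `m + (g − m) = g` in `ℕ`, packaged for the Vandermonde bounds. -/
theorem choose_add_sub {g m k : ℕ} (hmg : m ≤ g) : (m + (g - m)).choose k = g.choose k := by
  rw [Nat.add_sub_cancel' hmg]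

/-- `N₄^g(g, [m]) ≥ 0` for `3 ≤ m ≤ g`. -/
theorem N4g_single_nonneg {g m : ℕ} (hm3 : 3 ≤ m) (hmg : m ≤ g) : 0 ≤ N4g g [m] := by
  rw [N4g_single hm3 hmg]
  have := vandermonde_two_cast m (g - m) (k := 4) (by norm_num)
  rw [choose_add_sub hmg] at this
  simp only [show (4 : ℕ) - 1 = 3 by norm_num] at this
  linarith

/-- `d₅(g, [m]) ≥ 0` for `m ≤ g`. -/
theorem ds_single_five_nonneg {g m : ℕ} (hmg : m ≤ g) : 0 ≤ ds g [m] 5 := by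
  rw [ds_single]
  simp only [show ¬ (6 ≤ 5) by norm_num, if_false]
  have := vandermonde_two_cast m (g - m) (k := 5) (by norm_num)
  rw [choose_add_sub hmg] at this
  simp only [show (5 : ℕ) - 1 = 4 by norm_num] at this
  linarith

/-- `rest_s(g, [m]) ≥ 0` for `s ≥ 6`, `m ≤ g` (Vandermonde). -/
theorem rests_single_nonneg {g m s : ℕ} (hmg : m ≤ g) (hs : 6 ≤ s) : 0 ≤ rests g [m] s := by
  rw [rests_single, ds_single, if_pos hs]
  have := vandermonde_three_cast m (g - m) (k := s) (by omega)
  rw [choose_add_sub hmg] at this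
  have e : ((m.choose (s - 2) : ℕ) : ℚ) * (((g - m).choose 2 : ℕ) : ℚ) =
      (((g - m).choose 2 : ℕ) : ℚ) * ((m.choose (s - 2) : ℕ) : ℚ) := mul_comm _ _
  linarith

/-- `rest₅(g, [m]) = 0`. -/
theorem rests_single_five (g m : ℕ) : rests g [m] 5 = 0 := by
  rw [rests_single, ds_single]
  simp only [show ¬ (6 ≤ 5) by norm_num, if_false]
  ring

/-- The lower bound on the summand of `[m]`: the lp / `(s−2)` / rest counts at their minimal values. -/
theorem summand_single_ge {t g m : ℕ} (ht : t = 1 ∨ t = 2 ∨ t = 3) (hmg : m ≤ g) {s : ℕ} (hs : 5 ≤ s) :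
    lps g [m] s * vLp5 t + (if 6 ≤ s then ds g [m] s * vNon5 t + rests g [m] s * r6 t else 0) ≤
      summand t g [m] s := by
  unfold summand
  have hl : 0 ≤ lps g [m] s := by rw [lps_single]; positivity
  have h1 : lps g [m] s * vLp5 t ≤ lps g [m] s * vLp t s := mul_le_mul_of_nonneg_left (vLp_ge ht hs) hl
  split_ifs with h6
  · have hd : 0 ≤ ds g [m] s := by rw [ds_single, if_pos h6]; positivity
    have hr : 0 ≤ rests g [m] s := rests_single_nonneg hmg h6
    have h2 : ds g [m] s * vNon5 t ≤ ds g [m] s * vNon t s := mul_le_mul_of_nonneg_left (vNon_ge ht hs) hd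
    have h3 : rests g [m] s * r6 t ≤ rests g [m] s * vRest t s := mul_le_mul_of_nonneg_left (vRest_ge ht h6) hr
    linarith
  · have h5 : s = 5 := by omega
    subst h5
    have h2 : 0 ≤ ds g [m] 5 * vNon t 5 := mul_nonneg (ds_single_five_nonneg hmg) (vNon_nonneg ht 5)
    rw [rests_single_five]
    linarith

/-- `Σ_{s ∈ Icc 5 g} C(m, s − 1) = 2^m − S₃(m)` for `m + 1 ≤ g`, `g ≥ 4`. -/
theorem sum_Icc_five_shift {g m : ℕ} (hmg : m + 1 ≤ g) (hg : 5 ≤ g) :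
    ∑ s ∈ Finset.Icc 5 g, ((m.choose (s - 1) : ℕ) : ℚ) = 2 ^ m - S3 m := by
  rw [sum_Icc_shift (fun r => ((m.choose r : ℕ) : ℚ)) (by norm_num : 1 ≤ 5) (by omega : 5 ≤ g)]
  have := sum_Icc_four_choose (m := m) (n := g - 1) (by omega) (by omega)
  push_cast at this
  simpa using this

/-- `C(g−m, 2) · Σ_{s ∈ Icc 6 g} C(m, s − 2) = C(g−m, 2) · (2^m − S₃(m))` for `m + 1 ≤ g`, `g ≥ 5`
(for `g − m = 1` both sides vanish). -/
theorem sum_Icc_six_shift {g m : ℕ} (hmg : m + 1 ≤ g) (hg : 6 ≤ g) :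
    (((g - m).choose 2 : ℕ) : ℚ) * ∑ s ∈ Finset.Icc 6 g, ((m.choose (s - 2) : ℕ) : ℚ) =
      (((g - m).choose 2 : ℕ) : ℚ) * (2 ^ m - S3 m) := by
  rcases Nat.eq_or_lt_of_le hmg with h1 | h2
  · have : g - m = 1 := by omega
    rw [this]; simp
  · rw [sum_Icc_shift (fun r => ((m.choose r : ℕ) : ℚ)) (by norm_num : 2 ≤ 6) (by omega : 6 ≤ g)]
    have := sum_Icc_four_choose (m := m) (n := g - 2) (by omega) (by omega)
    push_cast at this
    simp only [show (6 : ℕ) - 2 = 4 by norm_num]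
    rw [this]

/-- `Σ_{s ∈ Icc 6 g} rest_s(g, [m]) ≥ 2^g − S₅(g) − (1 + (g − m) + C(g − m, 2))·2^m` for `g ≥ 6`. -/
theorem sum_rests_single_ge (m : ℕ) {g : ℕ} (hg : 6 ≤ g) :
    2 ^ g - S5 g - (1 + ((g - m : ℕ) : ℚ) + (((g - m).choose 2 : ℕ) : ℚ)) * 2 ^ m ≤
      ∑ s ∈ Finset.Icc 6 g, rests g [m] s := by
  have e : ∀ s ∈ Finset.Icc 6 g, rests g [m] s = ((g.choose s : ℕ) : ℚ) - ((m.choose s : ℕ) : ℚ) -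
      ((g - m : ℕ) : ℚ) * ((m.choose (s - 1) : ℕ) : ℚ) - (((g - m).choose 2 : ℕ) : ℚ) * ((m.choose (s - 2) : ℕ) : ℚ) := by
    intro s hs
    rw [rests_single, ds_single, if_pos (Finset.mem_Icc.1 hs).1]
    ring
  rw [Finset.sum_congr rfl e]
  simp only [Finset.sum_sub_distrib, ← Finset.mul_sum]
  have h0 := sum_Icc_six_choose (by omega : 5 ≤ g)
  push_cast at h0
  have h1 : ∑ s ∈ Finset.Icc 6 g, ((m.choose s : ℕ) : ℚ) ≤ 2 ^ m := by
    have := sum_Icc_choose_le m 6 g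
    exact_mod_cast this
  have h2 : ∑ s ∈ Finset.Icc 6 g, ((m.choose (s - 1) : ℕ) : ℚ) ≤ 2 ^ m := by
    have := sum_Icc_choose_sub_le m (a := 6) (b := g) (k := 1) (by norm_num) (by omega)
    exact_mod_cast this
  have h3 : ∑ s ∈ Finset.Icc 6 g, ((m.choose (s - 2) : ℕ) : ℚ) ≤ 2 ^ m := by
    have := sum_Icc_choose_sub_le m (a := 6) (b := g) (k := 2) (by norm_num) (by omega)
    exact_mod_cast this
  have hj : (0 : ℚ) ≤ ((g - m : ℕ) : ℚ) := by positivity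
  have hc : (0 : ℚ) ≤ (((g - m).choose 2 : ℕ) : ℚ) := by positivity
  rw [h0]
  nlinarith [mul_le_mul_of_nonneg_left h2 hj, mul_le_mul_of_nonneg_left h3 hc]

/-- **The lower bound on `F_t(g, [m])`** for `3 ≤ m`, `m + 1 ≤ g`, `g ≥ 5`:
`F ≥ v^{lp}(5)·(g−m)·(2^m − S₃(m)) + v^{s−2}(5)·C(g−m,2)·(2^m − S₃(m)) + r₆·(2^g − S₅(g) − (1 + (g−m) + C(g−m,2))·2^m)`. -/
theorem F_single_ge {t g m : ℕ} (ht : t = 1 ∨ t = 2 ∨ t = 3) (hm3 : 3 ≤ m) (hmg : m + 1 ≤ g) (hg : 6 ≤ g) :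
    vLp5 t * ((g - m : ℕ) : ℚ) * (2 ^ m - S3 m) + vNon5 t * (((g - m).choose 2 : ℕ) : ℚ) * (2 ^ m - S3 m) +
      r6 t * (2 ^ g - S5 g - (1 + ((g - m : ℕ) : ℚ) + (((g - m).choose 2 : ℕ) : ℚ)) * 2 ^ m) ≤ F t g [m] := by
  have hmg' : m ≤ g := by omega
  have e : F t g [m] = Tcnt g [m] * vTriple t + N4g g [m] * vGen4 t + N4c g [m] * vCol4 t +
      sumIcc (summand t g [m]) 5 g := rfl
  rw [e]
  have h1 : 0 ≤ Tcnt g [m] * vTriple t := by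
    apply mul_nonneg _ (vTriple_nonneg ht)
    rw [Tcnt_single]
    have : (m.choose 3 : ℚ) ≤ (g.choose 3 : ℚ) := by exact_mod_cast Nat.choose_le_choose 3 hmg'
    linarith
  have h2 : 0 ≤ N4g g [m] * vGen4 t := mul_nonneg (N4g_single_nonneg hm3 hmg') (vGen4_nonneg ht)
  have h3 : 0 ≤ N4c g [m] * vCol4 t := by
    apply mul_nonneg _ (vCol4_nonneg ht)
    rw [N4c_single]; positivity
  -- the sum, bounded below termwise and then evaluated
  set lowA : ℕ → ℚ := fun s => lps g [m] s * vLp5 t with hlowA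
  set lowB : ℕ → ℚ := fun s => if 6 ≤ s then ds g [m] s * vNon5 t + rests g [m] s * r6 t else 0 with hlowB
  have h4 : sumIcc (fun s => lowA s + lowB s) 5 g ≤ sumIcc (summand t g [m]) 5 g :=
    sumIcc_le_sumIcc 5 (fun s hs => summand_single_ge ht hmg' hs) g
  rw [sumIcc_add] at h4
  -- `Σ lowA`
  have hA : sumIcc lowA 5 g = vLp5 t * ((g - m : ℕ) : ℚ) * (2 ^ m - S3 m) := by
    rw [sumIcc_eq_finset]
    simp only [hlowA, lps_single]
    rw [← sum_Icc_five_shift hmg (by omega), Finset.mul_sum]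
    apply Finset.sum_congr rfl
    intro s _
    ring
  -- `Σ lowB`
  have hB : sumIcc lowB 5 g = vNon5 t * (((g - m).choose 2 : ℕ) : ℚ) * (2 ^ m - S3 m) +
      r6 t * ∑ s ∈ Finset.Icc 6 g, rests g [m] s := by
    rw [sumIcc_succ_left _ (by omega : 5 ≤ g), sumIcc_eq_finset]
    have h5 : lowB 5 = 0 := by simp [hlowB]
    rw [h5, zero_add]
    have e6 : ∀ s ∈ Finset.Icc 6 g, lowB s = (((g - m).choose 2 : ℕ) : ℚ) * vNon5 t * ((m.choose (s - 2) : ℕ) : ℚ) +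
        r6 t * rests g [m] s := by
      intro s hs
      simp only [hlowB, if_pos (Finset.mem_Icc.1 hs).1, ds_single]
      ring
    rw [Finset.sum_congr rfl e6, Finset.sum_add_distrib, ← Finset.mul_sum, ← Finset.mul_sum]
    have := sum_Icc_six_shift hmg hg
    have e7 : (((g - m).choose 2 : ℕ) : ℚ) * vNon5 t * ∑ s ∈ Finset.Icc 6 g, ((m.choose (s - 2) : ℕ) : ℚ) =
        vNon5 t * ((((g - m).choose 2 : ℕ) : ℚ) * ∑ s ∈ Finset.Icc 6 g, ((m.choose (s - 2) : ℕ) : ℚ)) := by ring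
    rw [e7, this]
    ring
  have hR := sum_rests_single_ge m hg
  have hr6 : 0 ≤ r6 t := by linarith [r6_ge ht]
  have hR' := mul_le_mul_of_nonneg_left hR hr6
  rw [hA, hB] at h4
  linarith


/-! ## Part V: `Δ_t(g, [m]) ≥ 2^m·c_t(j) − loss`, the coefficient `c_t(j)` and the polynomial loss -/

/-- `cNum t j = 2^j·c_t(j)`: the coefficient of `2^m` in the lower bound on `Δ_t(g, [g − j])`. -/
def cNum (t j : ℕ) : ℚ :=
  vLp5 t * j + vNon5 t * (j.choose 2 : ℕ) + r6 t * (2 ^ j - 1 - j - (j.choose 2 : ℕ)) - 3 * 2 ^ j + 3 +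
    (if t = 3 then 3 else 0)

/-- The polynomial loss in the lower bound on `Δ_t(g, [m])`. -/
def loss (t g m : ℕ) : ℚ :=
  (vLp5 t * ((g - m : ℕ) : ℚ) + vNon5 t * (((g - m).choose 2 : ℕ) : ℚ)) * S3 m + r6 t * S5 g + 3 * S2 m +
    (if t = 3 then 3 else 0) * (m + 1)

/-- **The one-line bound**: `Δ_t(g, [m]) ≥ 2^m·cNum_t(g − m) − loss_t(g, m)` for `3 ≤ m`, `m + 1 ≤ g`, `g ≥ 6`. -/
theorem Δ_single_ge {t g m : ℕ} (ht : t = 1 ∨ t = 2 ∨ t = 3) (hm3 : 3 ≤ m) (hmg : m + 1 ≤ g) (hg : 6 ≤ g) :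
    2 ^ m * cNum t (g - m) - loss t g m ≤ Δ t g [m] := by
  have hF := F_single_ge ht hm3 hmg hg
  have hD := D_single_le ht (by omega) (by omega : m ≤ g)
  have e : (2 : ℚ) ^ g = 2 ^ (g - m) * 2 ^ m := by
    rw [← pow_add, Nat.sub_add_cancel (by omega : m ≤ g)]
  simp only [Δ, cNum, loss]
  rw [e] at hF hD
  have hj : ((g - m : ℕ) : ℚ) = ((g - m : ℕ) : ℚ) := rfl
  linarith

/-- `8192·(1 + j) ≤ 92·2^j` for `j ≥ 13`. -/
theorem lin_le_two_pow {j : ℕ} (hj : 13 ≤ j) : 8192 * (1 + j) ≤ 92 * 2 ^ j := by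
  induction j, hj using Nat.le_induction with
  | base => norm_num
  | succ n hn ih => rw [pow_succ]; omega

/-- `8192·(1 + j + C(j,2)) ≤ 92·2^j` for `j ≥ 13`. -/
theorem quad_le_two_pow {j : ℕ} (hj : 13 ≤ j) : 8192 * (1 + j + j.choose 2) ≤ 92 * 2 ^ j := by
  induction j, hj using Nat.le_induction with
  | base => decide
  | succ n hn ih =>
    have h1 := lin_le_two_pow hn
    have e : (n + 1).choose 2 = n + n.choose 2 := by
      have := Nat.choose_succ_succ' n 1
      simpa [Nat.choose_one_right] using this
    rw [e, pow_succ]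
    omega

/-- The finite check `cNum_t(j) ≥ 2^j/2` for `2 ≤ j ≤ 12`. -/
def cNumOK (t : ℕ) : Bool :=
  (List.range 11).all fun i => decide ((2 : ℚ) ^ (i + 2) / 2 ≤ cNum t (i + 2))

/-- `t = 1`. -/
theorem cNumOK_one : cNumOK 1 = true := by decide +kernel
/-- `t = 2`. -/
theorem cNumOK_two : cNumOK 2 = true := by decide +kernel
/-- `t = 3`. -/
theorem cNumOK_three : cNumOK 3 = true := by decide +kernel

/-- **`cNum_t(j) ≥ 2^j / 2` for every `j ≥ 2`** (finite check to `12`, the `r₆`-tail beyond). -/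
theorem cNum_ge {t j : ℕ} (ht : t = 1 ∨ t = 2 ∨ t = 3) (hj : 2 ≤ j) : (2 : ℚ) ^ j / 2 ≤ cNum t j := by
  rcases Nat.lt_or_ge 12 j with h13 | h12
  swap
  · have hok : cNumOK t = true := by rcases ht with rfl | rfl | rfl; exacts [cNumOK_one, cNumOK_two, cNumOK_three]
    unfold cNumOK at hok
    rw [List.all_eq_true] at hok
    have := hok (j - 2) (List.mem_range.2 (by omega))
    rw [show j - 2 + 2 = j by omega] at this
    exact of_decide_eq_true this
  · have hq : (8192 : ℚ) * (1 + j + (j.choose 2 : ℕ)) ≤ 92 * 2 ^ j := by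
      exact_mod_cast quad_le_two_pow (by omega : 13 ≤ j)
    have hr := r6_ge ht
    have hr' := r6_le ht
    have h1 : 0 ≤ vLp5 t * j := mul_nonneg (vLp5_nonneg ht) (by positivity)
    have h2 : 0 ≤ vNon5 t * (j.choose 2 : ℕ) := mul_nonneg (vNon5_nonneg ht) (by positivity)
    have h3 : (0 : ℚ) ≤ (if t = 3 then 3 else 0) := by split_ifs <;> norm_num
    have hp : (0 : ℚ) ≤ 2 ^ j := by positivity
    have h4 : r6 t * (8192 * (1 + j + (j.choose 2 : ℕ))) ≤ r6 t * (92 * 2 ^ j) :=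
      mul_le_mul_of_nonneg_left hq (by linarith)
    have h5 : (49 / 10 : ℚ) * 2 ^ j ≤ r6 t * 2 ^ j := mul_le_mul_of_nonneg_right hr hp
    unfold cNum
    nlinarith

/-- Line + point: `cNum_t(1) = v^{lp}(5) − 3 + 3·[t = 3] ≥ 1/2`. -/
theorem cNum_one_ge {t : ℕ} (ht : t = 1 ∨ t = 2 ∨ t = 3) : 1 / 2 ≤ cNum t 1 := by
  have := vLp5_linePoint ht
  unfold cNum
  simp only [Nat.cast_one]
  norm_num
  linarith

end PercRepro.SixThree.Table
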